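import Summits.BirchSwinnertonDyer.BirchSwinnertonDyer.Theorems.KolyvaginRankRigidityAtTwoRegularRefillLagrangianPair
import HarnessLib

/-!
# Crux U1 `KolyvaginBoundedDefectAtTwo` (stmt-BirchSwinnertonDyer-28083), LINE 17 `kolyvagin_swap` —
# the SIGNED REFILL LAW (pure finite-group algebra): for an involution-stable Lagrangian `X` in g13's
# complementary-pair setting, `16 · π_tr(σ x + s x) ∈ X ∩ H_tr` for every `x ∈ X`; hence a SIGNED SUPPLY:
# if `2^a` kills the `s`-symmetrised Kummer cut, `X ∩ H_tr` holds an EXACT `s`-eigenvector of order `≥ 2^(e−a−5)`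

Width seat `bsd-line-krr2-p2` g18 (ONE READER on LINE 17; pen v7.7's typed sub-target SRS `SignedRefillSupplyAtTwo`
of SWα); `--supports stmt-BirchSwinnertonDyer-28083` (helper). THEOREMS ONLY, PURE ALGEBRA: nothing here proves SRS,
SWα, U1, a rung or BSD. BSD is NOT proved.

## Setting (g13's, `…RegularRefillLagrangianPair`, + g14's involution of `…RegularRefillSign`)
`L` finite, `n • L = 0`; `b : L × L → ℤ/n` bi-additive, SYMMETRIC, non-degenerate; `L = H_f ⊕ H_tr` with both
summands isotropic; `σ : L → L` an additive involution with `⟨σx, σy⟩ = ⟨x, y⟩`, `σ H_f ⊆ H_f`, `σ H_tr ⊆ H_tr`;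
`s = ±1`; `X ≤ L` isotropic with `#X = #H_f` (Lagrangian) and `σ X ⊆ X`. Write `sym y = σ y + s • y` (always an
EXACT `s`-eigenvector: `σ (sym y) = s • sym y`) and `π_f, π_tr` for the components in `H_f ⊕ H_tr`.

## What is proved
* `zsmul_sixteen_mem_of_lagrangian_of_symmetrised` — **THE SIGNED REFILL LAW.** If `2 · H_f^{σ = s}` lies in a cyclic
  group (`∃ g, ∀ f ∈ H_f, σ f = s f → 2 f ∈ ℤg` — at `2` on `H¹(K_λ, E[2^M])` this is the Kummer eigen-"line"
  `ℤ/2^M ⊕ ℤ/2` of this lineage's `kummer_eigen_at_two_of_index`, KUMMER SIDE ONLY), then for every `x ∈ X` the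
  transverse component `t` of `sym x = f + t` satisfies `16 • t ∈ X`. PROOF (no counting beyond g13's): the form
  `γ(d, d') = ⟨d, π_tr x_{d'}⟩` on `π_f(X)` (`x_{d'} ∈ X` any lift, MIRRORED graph lemma) is antisymmetric (isotropy of
  `X`, `H_f`, `H_tr`; symmetry of `b`) with radical `X ∩ H_f` (mirrored double annihilator); on exact `s`-eigenvectors
  `d, d₁` it is `8`-torsion, because `2d, 2d₁ ∈ ℤy₀` for a LIFTABLE `y₀` (subgroup of the cyclic `ℤg`) and
  `γ(y₀, y₀)` is `2`-torsion; cross-sign values are killed by symmetrising (`2⟨f, t⟩ = s⟨sym f, t⟩` for `t` exact).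
* `exists_eigen_mem_inf_of_lagrangian_of_symmetrised` — **SIGNED SUPPLY.** If moreover `2^a • sym(X ∩ H_f) = 0` and
  `2^e • sym k ≠ 0` for some `k ∈ H_f` with `a + 5 ≤ e`, then some `z ∈ X ∩ H_tr` has `σ z = s • z` and
  `2^(e − (a+5)) • z ≠ 0`: exponent transfer `H_f ↔ H_tr` by perfectness, `2^a • sym t' ∈ ann_{H_tr}(X ∩ H_f)`, g13's
  graph lemma, and the law.
In situ (separate file): `L = H¹(K_v, E[2^M])` at a seed place of index `≥ M + 1`, `b = inv_v(· ∪ₑ ·)`,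
`σ = conjActPlace τ`, `X = loc_v H¹_{𝓕(qe)^v}`, cut `loc_v H¹_{𝓕(e)}`, refill `loc_v H¹_{𝓕(qe)}` — the supply half of
the pen's signed refill law (card §v7.4/§v7.7 of LINE 17) with absolute loss, no regularity at the seed prime.
References (locators only; no cited FACT is declared): [cite: MazurRubin2004, Prop. 1.3.2, Thm. 2.3.4, §4.1 Prop. 4.1.5]
[cite: Howard2004HeegnerKolyvagin, Thm. 2.1.11, §1.5–1.6] [cite: Jetchev2008, §3.2 (2), Lemma 5.2 (iii)]
[cite: GrossLMS1991, §3 (3.3)–(3.4)] [cite: MilneADT2006, Ch. I §0 (0.19)].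
Design: no definitions; `Type*`-polymorphic; axioms `propext`, `Classical.choice`, `Quot.sound`.
-/

set_option autoImplicit false
-- the Theorems namespace of this sub repeats the summit name by design (D-0017 nested layout)
set_option linter.dupNamespace false

noncomputable section

open scoped Classical
open Function

namespace Summit.BirchSwinnertonDyer.BirchSwinnertonDyer.Theorems.KolyvaginAtTwo.RegularRefill

variable {L : Type*} [AddCommGroup L]

section SignedLaw

variable {n : ℕ} (b : L →+ L →+ ZMod n)
  (hn : ∀ x : L, n • x = 0) (hsymm : ∀ x y, b x y = b y x)
  {Hf Htr : AddSubgroup L} (hdisj : Hf ⊓ Htr = ⊥) (hcod : Hf ⊔ Htr = ⊤)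
  (hHf : ∀ x ∈ Hf, ∀ y ∈ Hf, b x y = 0) (hHtr : ∀ x ∈ Htr, ∀ y ∈ Htr, b x y = 0)
  (σ : L →+ L) (hσσ : ∀ x, σ (σ x) = x) (hσb : ∀ x y, b (σ x) (σ y) = b x y)
  (hσf : ∀ f ∈ Hf, σ f ∈ Hf) (hσt : ∀ t ∈ Htr, σ t ∈ Htr)
  {s : ℤ} (hs : s = 1 ∨ s = -1)

/-! ### §1 The symmetriser `sym y = σ y + s • y` and the involution -/

include hσσ hs in
/-- `sym y = σ y + s • y` is an exact `s`-eigenvector of the involution `σ`. [folklore] -/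
theorem apply_symmetrised_eq_smul (y : L) : σ (σ y + s • y) = s • (σ y + s • y) := by
  have hss : s * s = 1 := by rcases hs with rfl | rfl <;> norm_num
  rw [map_add, map_zsmul, hσσ, smul_add, smul_smul, hss, one_smul, add_comm]

include hσσ hσb in
/-- `σ` is self-adjoint for `b`: `⟨σ x, y⟩ = ⟨x, σ y⟩` (invariance and `σ² = 1`). [folklore] -/
theorem apply_apply_eq_apply_apply (x y : L) : b (σ x) y = b x (σ y) := by
  conv_lhs => rw [← hσσ y]
  rw [hσb]

include hσσ hσb in
/-- The symmetriser is self-adjoint: `⟨sym x, y⟩ = ⟨x, sym y⟩`. [folklore] -/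
theorem apply_symmetrised_left (x y : L) : b (σ x + s • x) y = b x (σ y + s • y) := by
  rw [map_add, map_zsmul, AddMonoidHom.add_apply, AddMonoidHom.zsmul_apply,
    apply_apply_eq_apply_apply b σ hσσ hσb, map_add, map_zsmul]

include hσσ hσb hs in
/-- Against an EXACT `s`-eigenvector `t` (`σ t = s • t`): `⟨sym f, t⟩ = 2 s • ⟨f, t⟩`, i.e. `s • ⟨sym f, t⟩ = 2 • ⟨f, t⟩`
(cross-sign information is invisible, same-sign information is doubled). [folklore] -/
theorem smul_apply_symmetrised_of_eigen (f : L) {t : L} (ht : σ t = s • t) :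
    s • b (σ f + s • f) t = (2 : ℤ) • b f t := by
  have hss : s * s = 1 := by rcases hs with rfl | rfl <;> norm_num
  rw [apply_symmetrised_left b σ hσσ hσb, ht, ← two_zsmul, smul_smul, map_zsmul, smul_smul, ← mul_assoc,
    mul_comm s 2, mul_assoc, hss, mul_one]

include hdisj in
/-- Uniqueness of the decomposition along `H_f ⊕ H_tr`. [folklore] -/
theorem eq_and_eq_of_add_eq_add {f f' t t' : L} (hf : f ∈ Hf) (hf' : f' ∈ Hf) (ht : t ∈ Htr) (ht' : t' ∈ Htr)
    (h : f + t = f' + t') : f = f' ∧ t = t' := by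
  have h1 : f - f' = t' - t := by
    rw [sub_eq_sub_iff_add_eq_add, h, add_comm]
  have hmem : f - f' ∈ Hf ⊓ Htr :=
    AddSubgroup.mem_inf.mpr ⟨Hf.sub_mem hf hf', by rw [h1]; exact Htr.sub_mem ht' ht⟩
  rw [hdisj, AddSubgroup.mem_bot] at hmem
  refine ⟨sub_eq_zero.mp hmem, ?_⟩
  rw [hmem, eq_comm, sub_eq_zero] at h1
  exact h1.symm

include hdisj hcod hσf hσt in
/-- The components of `sym x` along `H_f ⊕ H_tr` are the symmetrised components of `x`; in particular if
`sym x = f₀ + t₀` then `f₀ = sym f` and `t₀ = sym t` for the decomposition `x = f + t`. [folklore] -/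
theorem exists_decomp_symmetrised {x f₀ t₀ : L} (hf₀ : f₀ ∈ Hf) (ht₀ : t₀ ∈ Htr)
    (h : f₀ + t₀ = σ x + s • x) :
    ∃ f ∈ Hf, ∃ t ∈ Htr, f + t = x ∧ f₀ = σ f + s • f ∧ t₀ = σ t + s • t := by
  have hx : x ∈ Hf ⊔ Htr := by rw [hcod]; exact AddSubgroup.mem_top x
  obtain ⟨f, hf, t, ht, rfl⟩ := AddSubgroup.mem_sup.mp hx
  have hdec : f₀ + t₀ = (σ f + s • f) + (σ t + s • t) := by
    rw [h, map_add, smul_add]; abel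
  obtain ⟨h1, h2⟩ := eq_and_eq_of_add_eq_add hdisj hf₀ (Hf.add_mem (hσf f hf) (Hf.zsmul_mem hf s)) ht₀
    (Htr.add_mem (hσt t ht) (Htr.zsmul_mem ht s)) hdec
  exact ⟨f, hf, t, ht, rfl, h1, h2⟩

/-! ### §2 The signed refill law -/

include hn hsymm hdisj hcod hHf hHtr hσσ hσb hσf hσt hs in
/-- **THE SIGNED REFILL LAW** (`16 · π_tr(sym X) ⊆ X ∩ H_tr`). In the setting of this section, assume the exact
`s`-eigenvectors of `H_f` are «doubly cyclic»: `2 f ∈ ℤ g` for one `g ∈ L` and every `f ∈ H_f` with `σ f = s f`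
(at `2`: the Kummer eigen-part `ℤ/2^M ⊕ ℤ/2` at a Kolyvagin place). Then for every `x ∈ X` and the decomposition
`σ x + s x = f₀ + t₀` (`f₀ ∈ H_f`, `t₀ ∈ H_tr`): `16 • t₀ ∈ X`. See the module docstring for the proof.
[cite: MazurRubin2004, Prop. 1.3.2, §4.1 Prop. 4.1.5] [cite: Howard2004HeegnerKolyvagin, Thm. 2.1.11]
[cite: Jetchev2008, Lemma 5.2 (iii)] -/
theorem zsmul_sixteen_mem_of_lagrangian_of_symmetrised [Finite L] [NeZero n] (hinj : Injective b)
    (X : AddSubgroup L) (hX : ∀ x ∈ X, ∀ y ∈ X, b x y = 0) (hcard : Nat.card X = Nat.card Hf)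
    (hσX : ∀ x ∈ X, σ x ∈ X)
    (hline : ∃ g : L, ∀ f ∈ Hf, σ f = s • f → ∃ c : ℤ, (2 : ℤ) • f = c • g)
    {x : L} (hx : x ∈ X) {f₀ t₀ : L} (hf₀ : f₀ ∈ Hf) (ht₀ : t₀ ∈ Htr) (hdec : f₀ + t₀ = σ x + s • x) :
    (16 : ℤ) • t₀ ∈ X := by
  have hss : s * s = 1 := by rcases hs with rfl | rfl <;> norm_num
  obtain ⟨g, hg⟩ := hline
  -- mirrored data (the hypotheses are symmetric in `H_f`, `H_tr`)
  have hdisj' : Htr ⊓ Hf = ⊥ := by rwa [inf_comm]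
  have hcod' : Htr ⊔ Hf = ⊤ := by rwa [sup_comm]
  have hfT : Nat.card Hf = Nat.card Htr := natCard_eq_of_lagrangian_pair b hn hsymm hcod hHf hHtr hinj
  have hcard' : Nat.card X = Nat.card Htr := hcard.trans hfT
  set B : AddSubgroup L := X ⊓ Htr with hBdef
  -- `f₀`, `t₀` are exact `s`-eigenvectors
  obtain ⟨f, hf, t, ht, hxft, hf₀eq, ht₀eq⟩ := exists_decomp_symmetrised hdisj hcod σ hσf hσt hf₀ ht₀ hdec
  have ht₀eig : σ t₀ = s • t₀ := by rw [ht₀eq]; exact apply_symmetrised_eq_smul σ hσσ hs t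
  have hf₀eig : σ f₀ = s • f₀ := by rw [hf₀eq]; exact apply_symmetrised_eq_smul σ hσσ hs f
  have hx' : f₀ + t₀ ∈ X := by rw [hdec]; exact X.add_mem (hσX x hx) (X.zsmul_mem hx s)
  -- the mirrored double annihilator: it suffices to pair `16 • t₀` to zero with `ann_{H_f}(B)`
  have hgoal : (16 : ℤ) • t₀ ∈ (Htr ⊓ ⨅ f₁ ∈ (Hf ⊓ ⨅ a ∈ B, (b a).ker), (b f₁).ker : AddSubgroup L) := by
    rw [mem_inf_iInf_ker_iff]
    refine ⟨Htr.zsmul_mem ht₀ _, fun f₁ hf₁ ↦ ?_⟩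
    obtain ⟨hf₁, hf₁ann⟩ := (mem_inf_iInf_ker_iff b Hf B f₁).mp hf₁
    -- mirrored graph lemma: `f₁ = π_f(x₁)` for some `x₁ ∈ X`
    obtain ⟨x₁, hx₁, hx₁f₁⟩ := exists_mem_sub_mem_of_lagrangian b hn hsymm hdisj' hcod' hHtr hHf hinj X hX hcard'
      ((mem_inf_iInf_ker_iff b Hf (X ⊓ Htr) f₁).mpr ⟨hf₁, hf₁ann⟩)
    obtain ⟨t₁, ht₁def⟩ : ∃ t₁ : L, t₁ = x₁ - f₁ := ⟨_, rfl⟩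
    have ht₁ : t₁ ∈ Htr := by rw [ht₁def]; exact hx₁f₁
    have hx₁eq : f₁ + t₁ = x₁ := by rw [ht₁def]; abel
    -- the symmetrised lift `x₁' = d₁ + t₁'`
    obtain ⟨d₁, hd₁def⟩ : ∃ d₁ : L, d₁ = σ f₁ + s • f₁ := ⟨_, rfl⟩
    obtain ⟨t₁', ht₁'def⟩ : ∃ t₁' : L, t₁' = σ t₁ + s • t₁ := ⟨_, rfl⟩
    have hd₁ : d₁ ∈ Hf := by rw [hd₁def]; exact Hf.add_mem (hσf f₁ hf₁) (Hf.zsmul_mem hf₁ s)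
    have ht₁' : t₁' ∈ Htr := by rw [ht₁'def]; exact Htr.add_mem (hσt t₁ ht₁) (Htr.zsmul_mem ht₁ s)
    have hd₁eig : σ d₁ = s • d₁ := by rw [hd₁def]; exact apply_symmetrised_eq_smul σ hσσ hs f₁
    have hx₁' : d₁ + t₁' ∈ X := by
      have : d₁ + t₁' = σ x₁ + s • x₁ := by rw [hd₁def, ht₁'def, ← hx₁eq, map_add, smul_add]; abel
      rw [this]; exact X.add_mem (hσX x₁ hx₁) (X.zsmul_mem hx₁ s)
    -- `2 ⟨f₁, t₀⟩ = s ⟨d₁, t₀⟩`; so it suffices that `8 ⟨d₁, t₀⟩ = 0`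
    have hkey : (2 : ℤ) • b f₁ t₀ = s • b d₁ t₀ := by
      rw [hd₁def]; exact (smul_apply_symmetrised_of_eigen b σ hσσ hσb hs f₁ ht₀eig).symm
    suffices h8 : (8 : ℤ) • b d₁ t₀ = 0 by
      rw [map_zsmul, show (16 : ℤ) = 8 * 2 by norm_num, mul_smul, hkey, smul_comm, h8, smul_zero]
    -- the doubly-cyclic structure: `2 f₀, 2 d₁ ∈ ℤ y₀` with `y₀` liftable to `X`
    obtain ⟨c₀, hc₀⟩ := hg f₀ hf₀ hf₀eig
    obtain ⟨c₁, hc₁⟩ := hg d₁ hd₁ hd₁eig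
    obtain ⟨H, hH⟩ : ∃ H : AddSubgroup L,
        H = AddSubgroup.zmultiples ((2 : ℤ) • f₀) ⊔ AddSubgroup.zmultiples ((2 : ℤ) • d₁) := ⟨_, rfl⟩
    have hHle : H ≤ AddSubgroup.zmultiples g := by
      rw [hH, sup_le_iff]
      constructor
      · exact AddSubgroup.zmultiples_le_of_mem (AddSubgroup.mem_zmultiples_iff.mpr ⟨c₀, hc₀.symm⟩)
      · exact AddSubgroup.zmultiples_le_of_mem (AddSubgroup.mem_zmultiples_iff.mpr ⟨c₁, hc₁.symm⟩)
    obtain ⟨k, hk⟩ := (AddSubgroup.le_zmultiples_iff g H).mp hHle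
    obtain ⟨y₀, hy₀⟩ : ∃ y₀ : L, y₀ = k • g := ⟨_, rfl⟩
    rw [← hy₀] at hk
    have hy₀H : y₀ ∈ H := by rw [hk]; exact AddSubgroup.mem_zmultiples y₀
    have h2f₀ : (2 : ℤ) • f₀ ∈ AddSubgroup.zmultiples y₀ := by
      rw [← hk, hH]; exact AddSubgroup.mem_sup_left (AddSubgroup.mem_zmultiples _)
    have h2d₁ : (2 : ℤ) • d₁ ∈ AddSubgroup.zmultiples y₀ := by
      rw [← hk, hH]; exact AddSubgroup.mem_sup_right (AddSubgroup.mem_zmultiples _)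
    obtain ⟨m₀, hm₀⟩ := AddSubgroup.mem_zmultiples_iff.mp h2f₀
    obtain ⟨m₁, hm₁⟩ := AddSubgroup.mem_zmultiples_iff.mp h2d₁
    -- `y₀ = α (2 f₀) + β (2 d₁)`, so `x⋆ = α (2 x₀') + β (2 x₁') ∈ X` lifts `y₀`, with transverse part `t⋆`
    rw [hH] at hy₀H
    obtain ⟨u, hu, v, hv, huv⟩ := AddSubgroup.mem_sup.mp hy₀H
    obtain ⟨α, rfl⟩ := AddSubgroup.mem_zmultiples_iff.mp hu
    obtain ⟨β, rfl⟩ := AddSubgroup.mem_zmultiples_iff.mp hv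
    obtain ⟨tstar, htstar⟩ : ∃ tstar : L, tstar = α • ((2 : ℤ) • t₀) + β • ((2 : ℤ) • t₁') := ⟨_, rfl⟩
    have htstar_mem : tstar ∈ Htr := by
      rw [htstar]; exact Htr.add_mem (Htr.zsmul_mem (Htr.zsmul_mem ht₀ _) _) (Htr.zsmul_mem (Htr.zsmul_mem ht₁' _) _)
    have hxstar : y₀ + tstar ∈ X := by
      have : y₀ + tstar = α • ((2 : ℤ) • (f₀ + t₀)) + β • ((2 : ℤ) • (d₁ + t₁')) := by
        rw [← huv, htstar]; simp only [smul_add]; abel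
      rw [this]
      exact X.add_mem (X.zsmul_mem (X.zsmul_mem hx' _) _) (X.zsmul_mem (X.zsmul_mem hx₁' _) _)
    -- isotropy of `x⋆`: `2 ⟨y₀, t⋆⟩ = 0`
    have hy₀f : y₀ ∈ Hf := by
      rw [← huv]; exact Hf.add_mem (Hf.zsmul_mem (Hf.zsmul_mem hf₀ _) _) (Hf.zsmul_mem (Hf.zsmul_mem hd₁ _) _)
    have hiso : (2 : ℤ) • b y₀ tstar = 0 := by
      have h0 := hX _ hxstar _ hxstar
      simp only [map_add, AddMonoidHom.add_apply, hHf y₀ hy₀f y₀ hy₀f, hHtr tstar htstar_mem tstar htstar_mem,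
        hsymm tstar y₀, zero_add, add_zero] at h0
      rwa [← two_zsmul] at h0
    -- `2 x₀' − m₀ x⋆ = 2 t₀ − m₀ t⋆ ∈ B`, and `d₁ ∈ ann(B)`; hence `⟨d₁, 2 t₀⟩ = m₀ ⟨d₁, t⋆⟩`
    have hBmem : (2 : ℤ) • t₀ - m₀ • tstar ∈ B := by
      refine AddSubgroup.mem_inf.mpr ⟨?_, Htr.sub_mem (Htr.zsmul_mem ht₀ _) (Htr.zsmul_mem htstar_mem _)⟩
      have : (2 : ℤ) • t₀ - m₀ • tstar = (2 : ℤ) • (f₀ + t₀) - m₀ • (y₀ + tstar) := by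
        rw [smul_add ((2 : ℤ)) f₀ t₀, smul_add m₀ y₀ tstar, hm₀]; abel
      rw [this]
      exact X.sub_mem (X.zsmul_mem hx' _) (X.zsmul_mem hxstar _)
    have hd₁ann : ∀ b' ∈ B, b d₁ b' = 0 := by
      intro b' hb'
      have h0 := hX _ hx₁' _ (AddSubgroup.mem_inf.mp hb').1
      rwa [map_add, AddMonoidHom.add_apply, hHtr t₁' ht₁' b' (AddSubgroup.mem_inf.mp hb').2, add_zero] at h0
    have h2t₀ : (2 : ℤ) • b d₁ t₀ = m₀ • b d₁ tstar := by
      have h0 := hd₁ann _ hBmem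
      rwa [map_sub, map_zsmul, map_zsmul, sub_eq_zero] at h0
    -- `8 ⟨d₁, t₀⟩ = 2 m₀ m₁ ⟨y₀, t⋆⟩ = 0`
    have h4 : (4 : ℤ) • b d₁ t₀ = (m₀ * m₁) • b y₀ tstar := by
      calc (4 : ℤ) • b d₁ t₀ = (2 : ℤ) • ((2 : ℤ) • b d₁ t₀) := by
            rw [smul_smul]; norm_num
        _ = m₀ • b ((2 : ℤ) • d₁) tstar := by
            rw [h2t₀, smul_smul, map_zsmul, AddMonoidHom.zsmul_apply, smul_smul, mul_comm]
        _ = (m₀ * m₁) • b y₀ tstar := by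
            rw [← hm₁, map_zsmul, AddMonoidHom.zsmul_apply, smul_smul]
    calc (8 : ℤ) • b d₁ t₀ = (2 : ℤ) • ((4 : ℤ) • b d₁ t₀) := by rw [smul_smul]; norm_num
      _ = (m₀ * m₁) • ((2 : ℤ) • b y₀ tstar) := by rw [h4, smul_comm]
      _ = 0 := by rw [hiso, smul_zero]
  rw [inf_ann_ann_eq b hn hsymm hcod' hHtr hHf hinj B inf_le_right] at hgoal
  exact (AddSubgroup.mem_inf.mp hgoal).1

/-! ### §3 The signed supply -/

include hn hsymm hdisj hcod hHf hHtr hσσ hσb hσf hσt hs in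
/-- **SIGNED SUPPLY.** In the setting of `zsmul_sixteen_mem_of_lagrangian_of_symmetrised`, assume `2^a • sym` kills the
Kummer cut `X ∩ H_f` and `2^e • sym k ≠ 0` for some `k ∈ H_f`, `a + 5 ≤ e`. Then `X ∩ H_tr` contains an EXACT
`s`-eigenvector `z` (`σ z = s • z`) with `2^(e − (a + 5)) • z ≠ 0`. PROOF: if `2^e • sym` killed `H_tr` it would kill
`sym k` (adjointness + perfectness of `H_f × H_tr`), so `2^e • sym t' ≠ 0` for some `t' ∈ H_tr`; `2^a • sym t'`
annihilates the cut, lifts to `X` by g13's graph lemma, and the law gives `z = 2^(a+5) • sym t' ∈ X`.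
[cite: MazurRubin2004, §4.1 Prop. 4.1.5, Lemma 4.1.7] [cite: Howard2004HeegnerKolyvagin, §1.5–1.6, Thm. 2.1.11] -/
theorem exists_eigen_mem_inf_of_lagrangian_of_symmetrised [Finite L] [NeZero n] (hinj : Injective b)
    (X : AddSubgroup L) (hX : ∀ x ∈ X, ∀ y ∈ X, b x y = 0) (hcard : Nat.card X = Nat.card Hf)
    (hσX : ∀ x ∈ X, σ x ∈ X)
    (hline : ∃ g : L, ∀ f ∈ Hf, σ f = s • f → ∃ c : ℤ, (2 : ℤ) • f = c • g)
    {a e : ℕ} (hae : a + 5 ≤ e)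
    (hcut : ∀ y ∈ X ⊓ Hf, (2 : ℤ) ^ a • (σ y + s • y) = 0)
    (hbig : ∃ k ∈ Hf, (2 : ℤ) ^ e • (σ k + s • k) ≠ 0) :
    ∃ z ∈ X ⊓ Htr, σ z = s • z ∧ (2 : ℤ) ^ (e - (a + 5)) • z ≠ 0 := by
  have hss : s * s = 1 := by rcases hs with rfl | rfl <;> norm_num
  obtain ⟨k, hk, hkne⟩ := hbig
  -- exponent transfer: some `t' ∈ H_tr` has `2^e • sym t' ≠ 0`
  have htr : ∃ t' ∈ Htr, (2 : ℤ) ^ e • (σ t' + s • t') ≠ 0 := by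
    by_contra hall
    push Not at hall
    apply hkne
    refine eq_zero_of_mem_of_forall_mem b hcod hHf hinj
      (Hf.zsmul_mem (Hf.add_mem (hσf k hk) (Hf.zsmul_mem hk s)) _) fun t' ht' ↦ ?_
    rw [map_zsmul, AddMonoidHom.zsmul_apply, apply_symmetrised_left b σ hσσ hσb, ← map_zsmul, hall t' ht', map_zero]
  obtain ⟨t', ht', ht'ne⟩ := htr
  obtain ⟨w, hw⟩ : ∃ w : L, w = σ t' + s • t' := ⟨_, rfl⟩
  rw [← hw] at ht'ne
  have hwmem : w ∈ Htr := by rw [hw]; exact Htr.add_mem (hσt t' ht') (Htr.zsmul_mem ht' s)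
  have hweig : σ w = s • w := by rw [hw]; exact apply_symmetrised_eq_smul σ hσσ hs t'
  -- `t₁ = 2^a • w` annihilates the cut
  obtain ⟨t₁, ht₁⟩ : ∃ t₁ : L, t₁ = (2 : ℤ) ^ a • w := ⟨_, rfl⟩
  have ht₁mem : t₁ ∈ Htr := by rw [ht₁]; exact Htr.zsmul_mem hwmem _
  have ht₁eig : σ t₁ = s • t₁ := by rw [ht₁, map_zsmul, hweig, smul_comm]
  have ht₁ann : t₁ ∈ (Htr ⊓ ⨅ y ∈ X ⊓ Hf, (b y).ker : AddSubgroup L) := by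
    rw [mem_inf_iInf_ker_iff]
    refine ⟨ht₁mem, fun y hy ↦ ?_⟩
    rw [ht₁, map_zsmul, hw, ← apply_symmetrised_left b σ hσσ hσb, ← AddMonoidHom.zsmul_apply, ← map_zsmul,
      hcut y hy, map_zero, AddMonoidHom.zero_apply]
  -- graph lemma: `x₀ = f + t₁ ∈ X`; `sym x₀ = sym f + 2 s • t₁`
  obtain ⟨x₀, hx₀, hx₀t₁⟩ := exists_mem_sub_mem_of_lagrangian b hn hsymm hdisj hcod hHf hHtr hinj X hX hcard ht₁ann
  obtain ⟨f, hf⟩ : ∃ f : L, f = x₀ - t₁ := ⟨_, rfl⟩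
  have hfmem : f ∈ Hf := by rw [hf]; exact hx₀t₁
  have hdec : (σ f + s • f) + ((2 * s) • t₁) = σ x₀ + s • x₀ := by
    have hx₀eq : x₀ = f + t₁ := by rw [hf]; abel
    rw [hx₀eq, map_add, smul_add, ht₁eig, mul_smul, two_zsmul]; abel
  have h16 := zsmul_sixteen_mem_of_lagrangian_of_symmetrised b hn hsymm hdisj hcod hHf hHtr σ hσσ hσb hσf hσt hs hinj X
    hX hcard hσX hline hx₀ (Hf.add_mem (hσf f hfmem) (Hf.zsmul_mem hfmem s)) (Htr.zsmul_mem ht₁mem _) hdec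
  -- `z = 2^(a+5) • w`
  refine ⟨(2 : ℤ) ^ (a + 5) • w, AddSubgroup.mem_inf.mpr ⟨?_, Htr.zsmul_mem hwmem _⟩, ?_, ?_⟩
  · have h16' : (16 * (2 * s)) • t₁ ∈ X := by rw [mul_smul]; exact h16
    have h32 : (s * (16 * (2 * s))) • t₁ ∈ X := by rw [mul_smul]; exact X.zsmul_mem h16' s
    have h5 : s * (16 * (2 * s)) = 2 ^ 5 := by rcases hs with rfl | rfl <;> norm_num
    rw [h5, ht₁, smul_smul, ← pow_add, add_comm] at h32
    exact h32
  · rw [map_zsmul, hweig, smul_comm]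
  · rw [smul_smul, ← pow_add, Nat.sub_add_cancel hae]
    exact ht'ne

end SignedLaw

end Summit.BirchSwinnertonDyer.BirchSwinnertonDyer.Theorems.KolyvaginAtTwo.RegularRefill

end
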